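import Mathlib
import Summits.KontsevichZagierPeriods.Zeta5Search.GHatMomentsResidue
import HarnessLib

/-!
# ζ(5) search — gen-2 g9's MOMENT LEMMA `GHatMoments` is a THEOREM (part 2 of 2: reduction of `ĝ` to `𝔽_p`, degree count, assembly)

Cell `pub-zeta5` (HONEST FRAMING: systematic search; no irrationality claim unless certified), typer seat generation 10.
Discharges BY NAME `GHatMoments` (`Zeta5Search/UniversalDigitCells.lean` §5, REPORT-gen2-g9 §6.1 (a)–(c)): if `−N` (`N ≥ 1`) bounds every
class exponent from below and `(N−1)p + i ≤ 2d + 3`, then `Σ_{x deep} x^i ĝ_x ≡ 0 (mod p)`.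

PROOF (as on paper, REPORT-gen2-g9 §6.1).
* §C `cast_gHat`: in `ZMod p` the unit `ĝ_x = 2∏_{s ∉ class(x)} (s − x)^{netExp s}·[b₀/2 − x]` becomes `2∏_{w ≠ x̄} (w − x̄)^{E(w)}` with
  `E(w) = classExp b p w` — grouping the foreign positions `s` by residue `w = s mod p` gives the exponent `Σ_{s ∈ class(w)} netExp s`,
  and the centre bracket supplies exactly the `+1` that `classExp` adds at the class of the odd centre `b₀/2 ≡ w_c`.
* §D `sum_classExp_val`: `Σ_{w ∈ 𝔽_p} E(w) = Σ_{s ≤ b₀} netExp s + [b₀ odd] = (b₀+1) − Σ_j #block_j + 1 = 2Σ_j b_j − 6b₀ − 5 = −(2d+5)`.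
* §E `gHatMoments_holds`: by §B of part 1 the rational moment sum is `p`-integral and maps to `2·Σ_{x ∈ D} x^i ∏_{w≠x}(w−x)^{E(w)}`,
  which vanishes by the residue theorem in product form (part 1 §A, `sum_pow_mul_prod_zpow_eq_zero`) since
  `i + Σ_w (E(w)+N−1) = i − 2d − 5 + (N−1)p ≤ −2`.

`p`-adic congruences of rational numbers; nothing here bears on irrationality.
-/

open Finset

namespace Summit.KontsevichZagierPeriods.Zeta5Search.ClusterValuation

open Summit.KontsevichZagierPeriods.Zeta5Search.DualSeries (InBox)
open Summit.KontsevichZagierPeriods.Zeta5Search.WedgeDictionary (dOf)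
open Summit.KontsevichZagierPeriods.Zeta5Search.CasoratianValuation (InPolytope)
open Summit.KontsevichZagierPeriods.Zeta5Search.BigPrime (block)

section Cast

variable {p : ℕ} [hp : Fact p.Prime]

/-- `(s : ZMod p) = w ↔ s % p = w.val % p`. -/
theorem natCast_eq_iff_mod_eq (s : ℕ) (w : ZMod p) : (s : ZMod p) = w ↔ s % p = w.val % p := by
  conv_lhs => rw [← ZMod.natCast_zmod_val w]
  exact ZMod.natCast_eq_natCast_iff' _ _ _

/-- The fibre of `s ↦ s mod p` over `w` among the positions `0..b₀` is the residue class `classSet b p w.val`. -/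
theorem filter_natCast_eq_classSet (b : ℕ → ℤ) (w : ZMod p) :
    (range ((b 0).toNat + 1)).filter (fun s : ℕ => (s : ZMod p) = w) = classSet b p w.val := by
  ext s
  simp only [classSet, mem_filter, natCast_eq_iff_mod_eq]

/-- The centre criterion in `ZMod p` (`p` odd): `p ∣ 2y − b₀ ↔ ȳ = b₀/2`.  (`2 ≠ 0` in `ZMod p` for `p ≥ 5` is inlined; as a
named lemma it is the tree's `Literature.NumberTheory.GaloisRepresentations.Serre1968.two_ne_zero_of_five_le`.) -/
theorem centreIn_iff_cast (b : ℕ → ℤ) (hp5 : 5 ≤ p) (y : ℕ) :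
    CentreIn b p y ↔ (y : ZMod p) = ((b 0 : ℤ) : ZMod p) / 2 := by
  have h2 : (2 : ZMod p) ≠ 0 := by
    intro h
    have h' : ((2 : ℕ) : ZMod p) = 0 := by exact_mod_cast h
    rw [ZMod.natCast_eq_zero_iff] at h'
    have := Nat.le_of_dvd two_pos h'
    omega
  rw [CentreIn, ← ZMod.intCast_zmod_eq_zero_iff_dvd, eq_div_iff h2]
  push_cast
  constructor
  · intro h; linear_combination h
  · intro h; linear_combination h

/-! ## §C  The unit `ĝ_x` in `ZMod p` -/

/-- **`ĝ_x` modulo `p`.**  For every position `x`, `ĝ_x` is `p`-integral and its image in `ZMod p` is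
`2 ∏_{w ≠ x̄} (w − x̄)^{classExp(w)}` (`x̄ = x mod p`; the class exponent includes the odd-centre correction). -/
theorem cast_gHat (b : ℕ → ℤ) (hp5 : 5 ≤ p) (x : ℕ) :
    ¬ p ∣ (gHat b p x).den ∧
    ((gHat b p x : ℚ) : ZMod p) = 2 * ∏ w ∈ univ.erase (x : ZMod p), (w - x) ^ classExp b p w.val := by
  classical
  set S := (range ((b 0).toNat + 1)).filter (fun s => s % p ≠ x % p) with hS
  -- the foreign factors are integer powers of integers prime to `p`
  have hfac : ∀ s ∈ S, ¬ (p : ℤ) ∣ ((s : ℤ) - x) := by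
    intro s hs h
    exact (mem_filter.1 hs).2 (Nat.modEq_iff_dvd.2 h).symm
  have hsx : ∀ s : ℕ, ((s : ℚ) - x) = (((s : ℤ) - x : ℤ) : ℚ) := fun s => by push_cast; ring
  have hden1 : ∀ s ∈ S, ¬ p ∣ (((s : ℚ) - x) ^ netExp b s).den := by
    intro s hs
    rw [hsx]
    exact PInt.zpow_int (hfac s hs) _
  have hcast1 : ∀ s ∈ S, ((((s : ℚ) - x) ^ netExp b s : ℚ) : ZMod p) = ((s : ZMod p) - x) ^ netExp b s := by
    intro s hs
    rw [hsx, PInt.cast_zpow_int (hfac s hs), Int.cast_sub, Int.cast_natCast, Int.cast_natCast]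
  have hdenP : ¬ p ∣ (∏ s ∈ S, ((s : ℚ) - x) ^ netExp b s).den := PInt.prod hden1
  have hcastP : ((∏ s ∈ S, ((s : ℚ) - x) ^ netExp b s : ℚ) : ZMod p) =
      ∏ s ∈ S, ((s : ZMod p) - x) ^ netExp b s := by
    rw [PInt.cast_prod hden1]
    exact prod_congr rfl hcast1
  -- group the foreign factors by residue class
  have hmaps : ∀ s ∈ S, (s : ZMod p) ∈ univ.erase (x : ZMod p) := by
    intro s hs
    refine mem_erase.2 ⟨fun h => (mem_filter.1 hs).2 ((ZMod.natCast_eq_natCast_iff' s x p).1 h), mem_univ _⟩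
  have hfib : ∏ s ∈ S, ((s : ZMod p) - x) ^ netExp b s =
      ∏ w ∈ univ.erase (x : ZMod p), (w - x) ^ (∑ s ∈ classSet b p w.val, netExp b s) := by
    rw [← prod_fiberwise_of_maps_to hmaps]
    refine prod_congr rfl fun w hw => ?_
    have hwx : w - (x : ZMod p) ≠ 0 := sub_ne_zero.2 (mem_erase.1 hw).1
    have hfilter : S.filter (fun s : ℕ => (s : ZMod p) = w) = classSet b p w.val := by
      rw [← filter_natCast_eq_classSet b w, hS, filter_filter]
      refine filter_congr fun s _ => ⟨fun h => h.2, fun h => ⟨fun hsx' => (mem_erase.1 hw).1 ?_, h⟩⟩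
      rw [← h, (ZMod.natCast_eq_natCast_iff' s x p).2 hsx']
    rw [hfilter, ← prod_zpow_eq_zpow_sum _ hwx]
    refine prod_congr rfl fun s hs => ?_
    rw [← filter_natCast_eq_classSet b w] at hs
    rw [(mem_filter.1 hs).2]
  -- the centre bracket
  set c : ZMod p := ((b 0 : ℤ) : ZMod p) / 2 with hc
  have hcorr : ∀ w : ZMod p, (¬ (2 : ℤ) ∣ b 0 ∧ CentreIn b p w.val) ↔ (¬ (2 : ℤ) ∣ b 0 ∧ w = c) := by
    intro w
    rw [centreIn_iff_cast b hp5, ZMod.natCast_zmod_val]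
  have h2Z : ¬ (p : ℤ) ∣ 2 := by
    intro h
    have := Int.le_of_dvd two_pos h
    have h5 : (5 : ℤ) ≤ p := by exact_mod_cast hp5
    omega
  have hxden : ¬ p ∣ (x : ℚ).den := by simpa using PInt.intCast (p := p) (x : ℤ)
  have hBden : ¬ p ∣ (if ¬ (2 : ℤ) ∣ b 0 ∧ ¬ CentreIn b p x then (b 0 : ℚ) / 2 - x else 1 : ℚ).den := by
    split_ifs
    · rw [div_eq_mul_inv, show (2 : ℚ) = ((2 : ℤ) : ℚ) by norm_num]
      exact PInt.sub (PInt.mul (PInt.intCast _) (PInt.inv_int h2Z)) hxden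
    · exact PInt.one
  have hBcast : ((if ¬ (2 : ℤ) ∣ b 0 ∧ ¬ CentreIn b p x then (b 0 : ℚ) / 2 - x else 1 : ℚ) : ZMod p) =
      if ¬ (2 : ℤ) ∣ b 0 ∧ ¬ CentreIn b p x then c - x else 1 := by
    split_ifs
    · have hd : ¬ p ∣ ((b 0 : ℚ) / 2).den := by
        rw [div_eq_mul_inv, show (2 : ℚ) = ((2 : ℤ) : ℚ) by norm_num]
        exact PInt.mul (PInt.intCast _) (PInt.inv_int h2Z)
      rw [PInt.cast_sub hd hxden, Rat.cast_div_of_ne_zero, Rat.cast_intCast, Rat.cast_natCast, hc]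
      · norm_num
      · simp
      · have h2 : (2 : ZMod p) ≠ 0 := by
          intro h
          have h' : ((2 : ℕ) : ZMod p) = 0 := by exact_mod_cast h
          rw [ZMod.natCast_eq_zero_iff] at h'
          have := Nat.le_of_dvd two_pos h'
          omega
        simpa using h2
    · exact Rat.cast_one
  -- the bracket equals the correction product `∏_{w ≠ x̄} (w − x̄)^{corr(w)}`
  have hBprod : (∏ w ∈ univ.erase (x : ZMod p),
      (w - x) ^ (if ¬ (2 : ℤ) ∣ b 0 ∧ CentreIn b p w.val then (1 : ℤ) else 0)) =
      if ¬ (2 : ℤ) ∣ b 0 ∧ ¬ CentreIn b p x then c - x else 1 := by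
    by_cases hev : (2 : ℤ) ∣ b 0
    · simp [hev]
    · have hxc : CentreIn b p x ↔ (x : ZMod p) = c := centreIn_iff_cast b hp5 x
      have h1 : (∏ w ∈ univ.erase (x : ZMod p),
          (w - x) ^ (if ¬ (2 : ℤ) ∣ b 0 ∧ CentreIn b p w.val then (1 : ℤ) else 0)) =
          ∏ w ∈ univ.erase (x : ZMod p), (if w = c then w - x else 1) := by
        refine prod_congr rfl fun w _ => ?_
        by_cases hcw : CentreIn b p w.val
        · have hwc : w = c := by rwa [centreIn_iff_cast b hp5, ZMod.natCast_zmod_val] at hcw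
          rw [if_pos ⟨hev, hcw⟩, if_pos hwc, zpow_one]
        · have hwc : w ≠ c := by rwa [centreIn_iff_cast b hp5, ZMod.natCast_zmod_val] at hcw
          rw [if_neg (fun h => hcw h.2), if_neg hwc, zpow_zero]
      rw [h1, prod_ite_eq']
      by_cases hcx : CentreIn b p x
      · rw [if_neg (fun h => (mem_erase.1 h).1 (hxc.1 hcx).symm), if_neg (fun h => h.2 hcx)]
      · rw [if_pos (mem_erase.2 ⟨fun h => hcx (hxc.2 h.symm), mem_univ _⟩), if_pos ⟨hev, hcx⟩]
  -- assemble
  refine ⟨?_, ?_⟩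
  · unfold gHat
    exact PInt.mul (PInt.mul (by simpa using PInt.intCast (p := p) 2) hdenP) hBden
  · unfold gHat
    rw [PInt.cast_mul (PInt.mul (by simpa using PInt.intCast (p := p) 2) hdenP) hBden,
      PInt.cast_mul (by simpa using PInt.intCast (p := p) 2) hdenP, hcastP, hfib, hBcast, ← hBprod,
      mul_assoc, ← prod_mul_distrib]
    congr 1
    · simp
    · refine prod_congr rfl fun w hw => ?_
      rw [← zpow_add₀ (sub_ne_zero.2 (mem_erase.1 hw).1)]
      rfl

end Cast

/-! ## §D  The degree count `Σ_{w ∈ 𝔽_p} classExp(w) = −(2d + 5)` -/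

section Degree

variable {p : ℕ} [hp : Fact p.Prime]

/-- `Σ_{s ≤ n} blockCount(s) = Σ_{j<7} (n + 1 − 2β_j)` (`n = b₀`, `β_j = b_{j+1}`, `2β_j ≤ n`). -/
theorem sum_blockCount (b : ℕ → ℤ) (hblk : ∀ i ∈ range 7, 2 * (b (i + 1)).toNat ≤ (b 0).toNat) :
    ∑ s ∈ range ((b 0).toNat + 1), blockCount b s = ∑ j ∈ range 7, ((b 0).toNat + 1 - 2 * (b (j + 1)).toNat) := by
  simp only [blockCount, card_eq_sum_ones, sum_filter]
  rw [sum_comm]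
  refine sum_congr rfl fun j hj => ?_
  rw [← sum_filter, ← card_eq_sum_ones, filter_mem_eq_inter,
    inter_eq_right.2 (fun s hs => mem_range.2 (by have := (mem_Icc.1 hs).2; omega)), block, Nat.card_Icc]
  have := hblk j hj
  omega

/-- `Σ_{s ≤ n} [2s = b₀] = [b₀ even]` (`0 ≤ b₀`). -/
theorem sum_centre_indicator (b : ℕ → ℤ) (hb0 : 0 ≤ b 0) :
    ∑ s ∈ range ((b 0).toNat + 1), (if 2 * (s : ℤ) = b 0 then (1 : ℤ) else 0) = if (2 : ℤ) ∣ b 0 then 1 else 0 := by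
  by_cases h2 : (2 : ℤ) ∣ b 0
  · obtain ⟨m, hm⟩ := h2
    rw [if_pos ⟨m, hm⟩]
    have hm0 : 0 ≤ m := by omega
    rw [show (∑ s ∈ range ((b 0).toNat + 1), (if 2 * (s : ℤ) = b 0 then (1 : ℤ) else 0)) =
        ∑ s ∈ range ((b 0).toNat + 1), (if s = m.toNat then (1 : ℤ) else 0) from
      sum_congr rfl fun s _ => by congr 1; apply propext; omega]
    rw [sum_ite_eq', if_pos (mem_range.2 (by omega))]
  · rw [if_neg h2]
    exact sum_eq_zero fun s _ => if_neg fun h => h2 ⟨s, by omega⟩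

/-- `Σ_{s ≤ b₀} netExp(s) = 2Σ_j b_j − 6b₀ − 6 + [b₀ even]`. -/
theorem sum_netExp (b : ℕ → ℤ) (hb0 : 0 ≤ b 0) (hblk : ∀ i ∈ range 7, 0 ≤ b (i + 1) ∧ 2 * b (i + 1) ≤ b 0) :
    ∑ s ∈ range ((b 0).toNat + 1), netExp b s =
      2 * (∑ j ∈ range 7, b (j + 1)) - 6 * b 0 - 6 + (if (2 : ℤ) ∣ b 0 then 1 else 0) := by
  have hblk' : ∀ i ∈ range 7, 2 * (b (i + 1)).toNat ≤ (b 0).toNat := by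
    intro i hi; have := hblk i hi; omega
  simp only [netExp, sum_add_distrib, sum_sub_distrib, sum_const, card_range, nsmul_eq_mul, mul_one]
  rw [sum_centre_indicator b hb0, ← Nat.cast_sum, sum_blockCount b hblk']
  have hcast : ((∑ j ∈ range 7, ((b 0).toNat + 1 - 2 * (b (j + 1)).toNat) : ℕ) : ℤ) =
      ∑ j ∈ range 7, (b 0 + 1 - 2 * b (j + 1)) := by
    rw [Nat.cast_sum]
    refine sum_congr rfl fun j hj => ?_
    have := hblk j hj
    have := hblk' j hj
    omega
  rw [hcast, sum_sub_distrib, sum_const, card_range, nsmul_eq_mul, mul_sum]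
  push_cast
  rw [Int.toNat_of_nonneg hb0]
  ring

/-- `Σ_{w ∈ 𝔽_p} [b₀ odd ∧ centre ∈ class(w)] = [b₀ odd]`. -/
theorem sum_centre_correction (b : ℕ → ℤ) (hp5 : 5 ≤ p) :
    ∑ w : ZMod p, (if ¬ (2 : ℤ) ∣ b 0 ∧ CentreIn b p w.val then (1 : ℤ) else 0) = if ¬ (2 : ℤ) ∣ b 0 then 1 else 0 := by
  by_cases hodd : ¬ (2 : ℤ) ∣ b 0
  · simp only [hodd, not_false_eq_true, true_and, if_true]
    rw [show (∑ w : ZMod p, (if CentreIn b p w.val then (1 : ℤ) else 0)) =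
        ∑ w : ZMod p, (if w = ((b 0 : ℤ) : ZMod p) / 2 then (1 : ℤ) else 0) from
      sum_congr rfl fun w _ => by
        by_cases hcw : CentreIn b p w.val
        · rw [if_pos hcw, if_pos (by rwa [centreIn_iff_cast b hp5, ZMod.natCast_zmod_val] at hcw)]
        · rw [if_neg hcw, if_neg (by rwa [centreIn_iff_cast b hp5, ZMod.natCast_zmod_val] at hcw)],
      sum_ite_eq', if_pos (mem_univ _)]
  · simp [hodd]

/-- **Degree count**: `Σ_{w ∈ 𝔽_p} classExp(w) = −(2d + 5)` on the polytope (`d = dOf b = 3b₀ − Σ_j b_j`). -/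
theorem sum_classExp_val (b : ℕ → ℤ) (hp5 : 5 ≤ p) (hb0 : 0 ≤ b 0)
    (hblk : ∀ i ∈ range 7, 0 ≤ b (i + 1) ∧ 2 * b (i + 1) ≤ b 0) :
    ∑ w : ZMod p, classExp b p w.val = -(2 * dOf b + 5) := by
  classical
  simp only [classExp, sum_add_distrib]
  rw [sum_centre_correction b hp5]
  have hfib : ∑ w : ZMod p, ∑ s ∈ classSet b p w.val, netExp b s = ∑ s ∈ range ((b 0).toNat + 1), netExp b s := by
    rw [← sum_fiberwise_of_maps_to (g := fun s : ℕ => (s : ZMod p)) (t := univ) (fun s _ => mem_univ _)]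
    exact sum_congr rfl fun w _ => by rw [filter_natCast_eq_classSet]
  rw [hfib, sum_netExp b hb0 hblk, dOf]
  split_ifs <;> ring

end Degree

/-! ## §E  Assembly -/

/-- **`GHatMoments` is a theorem** (gen-2 g9, REPORT-gen2-g9 §6.1: the mod-`p` moment sums of the deep units vanish inside the degree bound). -/
theorem gHatMoments_holds : GHatMoments := by
  intro b p N i hb hprime hp5 hN hEN hdeg
  haveI : Fact p.Prime := ⟨hprime⟩
  classical
  have hbox : InBox b := hb.1
  have hb0 : 0 ≤ b 0 := hbox.1
  have hblk : ∀ j ∈ range 7, 0 ≤ b (j + 1) ∧ 2 * b (j + 1) ≤ b 0 :=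
    fun j hj => ⟨(hbox.2 j hj).1, hb.2.1 j hj⟩
  -- the exponent function on `𝔽_p`
  set E : ZMod p → ℤ := fun w => classExp b p w.val with hE
  have hEN' : ∀ w, -(N : ℤ) ≤ E w := fun w => hEN w.val (ZMod.val_lt w)
  have hT : ∑ w, E w = -(2 * dOf b + 5) := sum_classExp_val b hp5 hb0 hblk
  have hdeg' : (i : ℤ) + ∑ w, (E w + N - 1) ≤ -2 := by
    have hsum : ∑ w, (E w + N - 1) = ∑ w, E w + (p : ℤ) * ((N : ℤ) - 1) := by
      simp only [sum_sub_distrib, sum_add_distrib, sum_const, card_univ, ZMod.card, nsmul_eq_mul]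
      ring
    rw [hsum, hT]
    linarith
  have hres := sum_pow_mul_prod_zpow_eq_zero E N i hN hEN' hdeg'
  -- the rational moment sum is `p`-integral and maps to twice the field sum
  have hden : ∀ x ∈ deepClasses b p N, ¬ p ∣ ((x : ℚ) ^ i * gHat b p x).den :=
    fun x _ => PInt.mul (PInt.natCast_pow x i) (cast_gHat b hp5 x).1
  have hcast : ((∑ x ∈ deepClasses b p N, (x : ℚ) ^ i * gHat b p x : ℚ) : ZMod p) =
      2 * ∑ x ∈ univ.filter (fun x => E x = -(N : ℤ)), x ^ i * ∏ w ∈ univ.erase x, (w - x) ^ E w := by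
    rw [PInt.cast_sum hden, mul_sum]
    refine sum_nbij' (fun x : ℕ => (x : ZMod p)) (fun w => w.val) ?_ ?_ ?_ ?_ ?_
    · intro x hx
      obtain ⟨hxr, hxE⟩ := mem_filter.1 (mem_coe.1 hx)
      refine mem_coe.2 (mem_filter.2 ⟨mem_univ _, ?_⟩)
      simp only [hE, ZMod.val_natCast, Nat.mod_eq_of_lt (mem_range.1 hxr), hxE]
    · intro w hw
      obtain ⟨-, hwE⟩ := mem_filter.1 (mem_coe.1 hw)
      exact mem_coe.2 (mem_filter.2 ⟨mem_range.2 (ZMod.val_lt w), hwE⟩)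
    · intro x hx
      obtain ⟨hxr, -⟩ := mem_filter.1 (mem_coe.1 hx)
      simp [ZMod.val_natCast, Nat.mod_eq_of_lt (mem_range.1 hxr)]
    · intro w _
      simp
    · intro x hx
      rw [PInt.cast_mul (PInt.natCast_pow x i) (cast_gHat b hp5 x).1, (cast_gHat b hp5 x).2, Rat.cast_pow,
        Rat.cast_natCast]
      ring
  refine PInt.pCong_of_cast_eq_zero (PInt.sum hden) ?_
  rw [hcast, hres, mul_zero]

end Summit.KontsevichZagierPeriods.Zeta5Search.ClusterValuation
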